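import Literature.NumberTheory.Transcendental.BeukersZetaThreeIntegrals
import Literature.NumberTheory.Transcendental.PennerWeilPeterssonVolumesProofs
import HarnessLib

/-!
# Beukers' lemma for `ζ(3)`, off-diagonal case: proof (Andrews–Askey–Roy 1999, Lemma 7.7.3)

Discharges the named fact
`Literature.NumberTheory.Transcendental.Beukers.logKernelIntegral_offDiag`
(`BeukersZetaThreeIntegrals.lean`) by the theorem `Beukers.logKernelIntegral_offDiag_holds`:
for integers `r > s ≥ 0`,

  `∫∫_{(0,1)²} -log(xy)/(1-xy) · xʳ yˢ dx dy = (1/(r-s)) · (1/(s+1)² + ⋯ + 1/r²)`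

[Andrews–Askey–Roy 1999, §7.7, Lemma 7.7.3 and its proof, pp. 391–392, following Beukers 1979].

## The printed argument and its formalization

The printed proof expands `1/(1-xy) = ∑ₖ (xy)ᵏ`, integrates term by term,
`∫₀¹∫₀¹ x^{r+σ+k} y^{s+σ+k} dx dy = 1/((k+r+σ+1)(k+s+σ+1))`, resolves into partial fractions
`= (1/(r-s)) (1/(k+s+σ+1) - 1/(k+r+σ+1))`, telescopes to
`(1/(r-s)) (1/(s+1+σ) + ⋯ + 1/(r+σ))` (display (7.7.2)), and finally differentiates with respect
to `σ` at `σ = 0`, which brings down the factor `log xy`. We run the same chain with the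
`σ`-derivative taken term by term *before* summing (so that no differentiation under the integral
sign is needed): with the logarithm kept in the integrand,

* `-log(xy)/(1-xy) · xʳyˢ = ∑ₖ -log(xy) x^{r+k} y^{s+k}` on the open square (geometric series,
  `logKernel_expansion`);
* `∫∫ -log(xy) xᵃ yᵇ = 1/((a+1)²(b+1)) + 1/((a+1)(b+1)²)` (`integral_unitSq_neg_log_mul_pow`:
  `-log(xy) = -log x - log y`, Fubini on the product `(0,1)²`, and the one-variable values
  `∫₀¹ xᵃ dx = 1/(a+1)`, `∫₀¹ xᵃ (-log x) dx = 1/(a+1)²`, the latter being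
  `Literature.NumberTheory.Transcendental.integral_pow_mul_log_zero_one`);
* the partial-fraction identity which is exactly the `σ`-derivative of the printed one: with
  `A = r+k+1`, `B = s+k+1`, `1/(A²B) + 1/(AB²) = (1/(A-B)) (1/B² - 1/A²)`;
* term-wise integration (`MeasureTheory.integral_tsum_of_summable_integral_norm`; the terms are
  nonnegative with summable integrals) and the telescoping
  `∑ₖ (1/(s+k+1)² - 1/(r+k+1)²) = ∑_{s<j≤r} 1/j²` (`tsum_one_div_sq_shift_sub`).

## References

* [AndrewsAskeyRoy1999] G. E. Andrews, R. Askey, R. Roy, *Special Functions*, Encyclopedia of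
  Mathematics and its Applications 71, Cambridge University Press (1999), §7.7 "The irrationality
  of `ζ(3)`", Lemma 7.7.3 and display (7.7.2), pp. 391–392 (held as
  `book:andrews1999-special-functions`; page-checked, PDF pp. 276–277).
* [Beukers1979] F. Beukers, *A note on the irrationality of `ζ(2)` and `ζ(3)`*, Bull. London
  Math. Soc. 11 (1979) 268–272 (the original of the lemma).
-/

noncomputable section

open MeasureTheory Set Filter

namespace Literature.NumberTheory.Transcendental

namespace Beukers

/- Throughout, the open unit square `(0,1)²` inside `Fin 2 → ℝ` is written in the literal shape
`{p : Fin 2 → ℝ | ∀ i, p i ∈ Ioo (0 : ℝ) 1}` of the integrals of `BeukersZetaThreeIntegrals.lean`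
(`p 0 = x`, `p 1 = y`). -/

/-! ## One-variable integrals on `(0,1)` -/

/-- `∫_{(0,1)} xⁿ dx = 1/(n+1)`. [folklore] -/
theorem integral_pow_Ioo_zero_one (n : ℕ) :
    ∫ x in Ioo (0 : ℝ) 1, x ^ n = 1 / ((n : ℝ) + 1) := by
  rw [← integral_Ioc_eq_integral_Ioo, ← intervalIntegral.integral_of_le zero_le_one, integral_pow]
  simp

/-- `∫_{(0,1)} xⁿ (−log x) dx = 1/(n+1)²` (set-integral form of
`integral_pow_mul_log_zero_one`). [folklore] -/
theorem integral_pow_mul_neg_log_Ioo_zero_one (n : ℕ) :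
    ∫ x in Ioo (0 : ℝ) 1, x ^ n * -Real.log x = 1 / ((n : ℝ) + 1) ^ 2 := by
  rw [← integral_Ioc_eq_integral_Ioo, ← intervalIntegral.integral_of_le zero_le_one]
  simp only [mul_neg, intervalIntegral.integral_neg, integral_pow_mul_log_zero_one]
  ring

/-- `xⁿ` is integrable on `(0,1)`. [folklore] -/
theorem integrableOn_pow_Ioo_zero_one (n : ℕ) :
    IntegrableOn (fun x : ℝ => x ^ n) (Ioo (0 : ℝ) 1) :=
  ((continuousOn_pow n).integrableOn_Icc (a := (0 : ℝ)) (b := 1)).mono_set Ioo_subset_Icc_self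

/-- `xⁿ (−log x)` is integrable on `(0,1)`. [folklore] -/
theorem integrableOn_pow_mul_neg_log_Ioo_zero_one (n : ℕ) :
    IntegrableOn (fun x : ℝ => x ^ n * -Real.log x) (Ioo (0 : ℝ) 1) := by
  have h : IntervalIntegrable (fun x : ℝ => x ^ n * -Real.log x) volume 0 1 :=
    intervalIntegral.intervalIntegrable_log'.neg.continuousOn_mul (continuousOn_pow n)
  exact ((intervalIntegrable_iff_integrableOn_Ioc_of_le zero_le_one).1 h).mono_set
    Ioo_subset_Ioc_self

/-! ## Fubini on the open unit square -/

/-- The open unit square is the product set `univ.pi fun _ => (0,1)`. [folklore] -/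
theorem unitSq_eq_pi :
    {p : Fin 2 → ℝ | ∀ i, p i ∈ Ioo (0 : ℝ) 1} = Set.pi univ fun _ : Fin 2 => Ioo (0 : ℝ) 1 := by
  ext p
  simp

/-- The open unit square is measurable. [folklore] -/
theorem measurableSet_unitSq : MeasurableSet {p : Fin 2 → ℝ | ∀ i, p i ∈ Ioo (0 : ℝ) 1} := by
  rw [unitSq_eq_pi]
  exact MeasurableSet.univ_pi fun _ => measurableSet_Ioo

/-- Fubini on the open unit square for a product `f(x) g(y)` of functions integrable on `(0,1)`:
the product is integrable on `(0,1)²` and its integral is the product of the integrals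
(`MeasureTheory.integral_fintype_prod_eq_prod` for `Measure.pi`). [folklore] -/
theorem integrableOn_unitSq_mul_and_integral_eq {f g : ℝ → ℝ} (hf : IntegrableOn f (Ioo 0 1))
    (hg : IntegrableOn g (Ioo 0 1)) :
    IntegrableOn (fun p : Fin 2 → ℝ => f (p 0) * g (p 1))
        {p : Fin 2 → ℝ | ∀ i, p i ∈ Ioo (0 : ℝ) 1} ∧
      ∫ p in {p : Fin 2 → ℝ | ∀ i, p i ∈ Ioo (0 : ℝ) 1}, f (p 0) * g (p 1) =
        (∫ x in Ioo (0 : ℝ) 1, f x) * ∫ y in Ioo (0 : ℝ) 1, g y := by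
  have hrestr : (volume : Measure (Fin 2 → ℝ)).restrict {p : Fin 2 → ℝ | ∀ i, p i ∈ Ioo (0 : ℝ) 1} =
      Measure.pi fun _ : Fin 2 => (volume : Measure ℝ).restrict (Ioo 0 1) := by
    rw [unitSq_eq_pi, volume_pi]
    exact Measure.restrict_pi_pi _ _
  let G : Fin 2 → ℝ → ℝ := ![f, g]
  have hGi : ∀ k, Integrable (G k) ((volume : Measure ℝ).restrict (Ioo 0 1)) :=
    Fin.forall_fin_two.mpr
      ⟨by simpa [G, IntegrableOn] using hf, by simpa [G, IntegrableOn] using hg⟩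
  have hprod : (fun p : Fin 2 → ℝ => f (p 0) * g (p 1)) = fun p => ∏ k, G k (p k) := by
    funext p
    simp [G, Fin.prod_univ_two]
  constructor
  · unfold IntegrableOn
    rw [hrestr, hprod]
    exact Integrable.fintype_prod (f := G) hGi
  · rw [hrestr, hprod, integral_fintype_prod_eq_prod G]
    simp [G, Fin.prod_univ_two]

/-! ## The terms of the expansion -/

/-- `∫∫_{(0,1)²} -log(xy) xᵃ yᵇ dx dy = 1/((a+1)²(b+1)) + 1/((a+1)(b+1)²)` (`a, b ∈ ℕ`), the
integrand being integrable on the open square: `-log(xy) = -log x - log y`, Fubini, and the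
one-variable values above. It is minus the `σ`-derivative at `σ = 0` of the printed
`∫∫ x^{a+σ} y^{b+σ} = 1/((a+σ+1)(b+σ+1))`. [cite: AndrewsAskeyRoy1999, Lemma 7.7.3 (proof)] -/
theorem integral_unitSq_neg_log_mul_pow (a b : ℕ) :
    IntegrableOn (fun p : Fin 2 → ℝ => -Real.log (p 0 * p 1) * (p 0 ^ a * p 1 ^ b))
        {p : Fin 2 → ℝ | ∀ i, p i ∈ Ioo (0 : ℝ) 1} ∧
      ∫ p in {p : Fin 2 → ℝ | ∀ i, p i ∈ Ioo (0 : ℝ) 1},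
          -Real.log (p 0 * p 1) * (p 0 ^ a * p 1 ^ b) =
        1 / (((a : ℝ) + 1) ^ 2 * ((b : ℝ) + 1)) + 1 / (((a : ℝ) + 1) * ((b : ℝ) + 1) ^ 2) := by
  obtain ⟨h1i, h1v⟩ := integrableOn_unitSq_mul_and_integral_eq
    (integrableOn_pow_mul_neg_log_Ioo_zero_one a) (integrableOn_pow_Ioo_zero_one b)
  obtain ⟨h2i, h2v⟩ := integrableOn_unitSq_mul_and_integral_eq
    (integrableOn_pow_Ioo_zero_one a) (integrableOn_pow_mul_neg_log_Ioo_zero_one b)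
  have hEq : EqOn
      (fun p : Fin 2 → ℝ => p 0 ^ a * -Real.log (p 0) * p 1 ^ b +
        p 0 ^ a * (p 1 ^ b * -Real.log (p 1)))
      (fun p : Fin 2 → ℝ => -Real.log (p 0 * p 1) * (p 0 ^ a * p 1 ^ b))
      {p : Fin 2 → ℝ | ∀ i, p i ∈ Ioo (0 : ℝ) 1} := by
    intro p hp
    have h0 := hp 0
    have h1 := hp 1
    simp only
    rw [Real.log_mul h0.1.ne' h1.1.ne']
    ring
  refine ⟨(h1i.add h2i).congr_fun hEq measurableSet_unitSq, ?_⟩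
  rw [← setIntegral_congr_fun measurableSet_unitSq hEq, integral_add h1i h2i, h1v, h2v,
    integral_pow_Ioo_zero_one, integral_pow_mul_neg_log_Ioo_zero_one,
    integral_pow_Ioo_zero_one, integral_pow_mul_neg_log_Ioo_zero_one]
  have ha : (a : ℝ) + 1 ≠ 0 := by positivity
  have hb : (b : ℝ) + 1 ≠ 0 := by positivity
  field_simp

/-- The expansion of the kernel on the open square: for `0 < x, y < 1`,
`-log(xy)/(1-xy) · xʳ yˢ = ∑ₖ -log(xy) x^{r+k} y^{s+k}` (geometric series), stated as a `HasSum`.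
[cite: AndrewsAskeyRoy1999, Lemma 7.7.3 (proof)] -/
theorem logKernel_hasSum_expansion (r s : ℕ) {p : Fin 2 → ℝ} (hp : ∀ i, p i ∈ Ioo (0 : ℝ) 1) :
    HasSum (fun k : ℕ => -Real.log (p 0 * p 1) * (p 0 ^ (r + k) * p 1 ^ (s + k)))
      (-Real.log (p 0 * p 1) / (1 - p 0 * p 1) * (p 0 ^ r * p 1 ^ s)) := by
  have h0 := hp 0
  have h1 := hp 1
  have hxy0 : 0 ≤ p 0 * p 1 := (mul_pos h0.1 h1.1).le
  have hxy1 : p 0 * p 1 < 1 := mul_lt_one_of_nonneg_of_lt_one_left h0.1.le h0.2 h1.2.le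
  have hs := (hasSum_geometric_of_lt_one hxy0 hxy1).mul_left
    (-Real.log (p 0 * p 1) * (p 0 ^ r * p 1 ^ s))
  have hval : -Real.log (p 0 * p 1) * (p 0 ^ r * p 1 ^ s) * (1 - p 0 * p 1)⁻¹ =
      -Real.log (p 0 * p 1) / (1 - p 0 * p 1) * (p 0 ^ r * p 1 ^ s) := by
    rw [div_eq_mul_inv]
    ring
  rw [← hval]
  refine hs.congr_fun fun k => ?_
  rw [mul_pow, pow_add, pow_add]
  ring

/-- The terms of the expansion are nonnegative on the open square. [folklore] -/
theorem logKernel_term_nonneg (a b : ℕ) {p : Fin 2 → ℝ} (hp : ∀ i, p i ∈ Ioo (0 : ℝ) 1) :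
    0 ≤ -Real.log (p 0 * p 1) * (p 0 ^ a * p 1 ^ b) := by
  have h0 := hp 0
  have h1 := hp 1
  have hxy1 : p 0 * p 1 < 1 := mul_lt_one_of_nonneg_of_lt_one_left h0.1.le h0.2 h1.2.le
  exact mul_nonneg (neg_nonneg.mpr (Real.log_nonpos (mul_pos h0.1 h1.1).le hxy1.le))
    (mul_nonneg (pow_nonneg h0.1.le _) (pow_nonneg h1.1.le _))

/-! ## Summation -/

/-- The shifted series `∑ₖ 1/(m+k+1)²` is summable. [folklore] -/
theorem summable_one_div_sq_shift (m : ℕ) :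
    Summable fun k : ℕ => 1 / ((m : ℝ) + k + 1) ^ 2 := by
  have hf : Summable fun n : ℕ => 1 / (n : ℝ) ^ 2 :=
    Real.summable_one_div_nat_pow.mpr one_lt_two
  rw [← summable_nat_add_iff (m + 1)] at hf
  refine hf.congr fun k => ?_
  push_cast
  ring

/-- Shifted tails of `∑ 1/n²`: `∑ₖ 1/(m+k+1)² = ∑ₙ 1/n² − ∑_{n ≤ m} 1/n²` (the term `n = 0`
contributes `0`). [folklore] -/
theorem tsum_one_div_sq_shift (m : ℕ) :
    ∑' k : ℕ, 1 / ((m : ℝ) + k + 1) ^ 2 =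
      ∑' n : ℕ, 1 / (n : ℝ) ^ 2 - ∑ n ∈ Finset.range (m + 1), 1 / (n : ℝ) ^ 2 := by
  have hf : Summable fun n : ℕ => 1 / (n : ℝ) ^ 2 :=
    Real.summable_one_div_nat_pow.mpr one_lt_two
  have h := hf.sum_add_tsum_nat_add (m + 1)
  have h' : ∑' k : ℕ, 1 / ((m : ℝ) + k + 1) ^ 2 = ∑' k : ℕ, 1 / (((k + (m + 1) : ℕ)) : ℝ) ^ 2 :=
    tsum_congr fun k => by push_cast; ring
  rw [h', ← h]
  ring

/-- The telescoping sum `∑ₖ (1/(s+k+1)² − 1/(r+k+1)²) = ∑_{s<j≤r} 1/j²` for `s ≤ r`: minus the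
`σ`-derivative at `σ = 0` of the printed display (7.7.2) (times `r - s`).
[cite: AndrewsAskeyRoy1999, (7.7.2)] -/
theorem tsum_one_div_sq_shift_sub {r s : ℕ} (h : s ≤ r) :
    ∑' k : ℕ, (1 / ((s : ℝ) + k + 1) ^ 2 - 1 / ((r : ℝ) + k + 1) ^ 2) =
      ∑ j ∈ Finset.Ioc s r, 1 / (j : ℝ) ^ 2 := by
  rw [(summable_one_div_sq_shift s).tsum_sub (summable_one_div_sq_shift r),
    tsum_one_div_sq_shift, tsum_one_div_sq_shift]
  have hIoc : Finset.Ioc s r = Finset.Ico (s + 1) (r + 1) := by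
    ext j
    simp only [Finset.mem_Ioc, Finset.mem_Ico]
    omega
  rw [hIoc, Finset.sum_Ico_eq_sub _ (Nat.succ_le_succ h)]
  ring

/-! ## The lemma -/

/-- **Beukers' lemma, off-diagonal case** (Andrews–Askey–Roy, Lemma 7.7.3, second case, with
the closed form printed in its proof; Beukers 1979): for integers `r > s ≥ 0`,
`∫₀¹∫₀¹ -log(xy)/(1-xy) · xʳ yˢ dx dy = (1/(r-s)) · (1/(s+1)² + ⋯ + 1/r²)`.
Discharges `logKernelIntegral_offDiag`. [cite: AndrewsAskeyRoy1999, Lemma 7.7.3] -/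
theorem logKernelIntegral_offDiag_holds : logKernelIntegral_offDiag := by
  intro r s hsr
  have hd : (0 : ℝ) < (r : ℝ) - s := sub_pos.mpr (by exact_mod_cast hsr)
  -- the terms of the expansion, their integrability and their integrals
  set g : ℕ → (Fin 2 → ℝ) → ℝ := fun k p =>
    -Real.log (p 0 * p 1) * (p 0 ^ (r + k) * p 1 ^ (s + k)) with hg_def
  have hg : ∀ k, IntegrableOn (g k) {p : Fin 2 → ℝ | ∀ i, p i ∈ Ioo (0 : ℝ) 1} ∧
      ∫ p in {p : Fin 2 → ℝ | ∀ i, p i ∈ Ioo (0 : ℝ) 1}, g k p =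
        (1 / ((s : ℝ) + k + 1) ^ 2 - 1 / ((r : ℝ) + k + 1) ^ 2) / ((r : ℝ) - s) := by
    intro k
    simp only [hg_def]
    obtain ⟨hi, hv⟩ := integral_unitSq_neg_log_mul_pow (r + k) (s + k)
    refine ⟨hi, ?_⟩
    rw [hv]
    have hA : (r : ℝ) + k + 1 ≠ 0 := by positivity
    have hB : (s : ℝ) + k + 1 ≠ 0 := by positivity
    have hAB : (r : ℝ) - s ≠ 0 := hd.ne'
    push_cast
    field_simp
    ring
  -- pointwise expansion on the open square
  have hexp : EqOn (fun p : Fin 2 → ℝ => ∑' k, g k p)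
      (fun p => -Real.log (p 0 * p 1) / (1 - p 0 * p 1) * (p 0 ^ r * p 1 ^ s))
      {p : Fin 2 → ℝ | ∀ i, p i ∈ Ioo (0 : ℝ) 1} := by
    intro p hp
    simp only [hg_def]
    exact (logKernel_hasSum_expansion r s hp).tsum_eq
  -- the integrals of the (nonnegative) terms are summable
  have hnorm : ∀ k,
      ∫ p in {p : Fin 2 → ℝ | ∀ i, p i ∈ Ioo (0 : ℝ) 1}, ‖g k p‖ =
        ∫ p in {p : Fin 2 → ℝ | ∀ i, p i ∈ Ioo (0 : ℝ) 1}, g k p := fun k =>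
    setIntegral_congr_fun measurableSet_unitSq fun p hp => by
      simp only [hg_def]
      exact Real.norm_of_nonneg (logKernel_term_nonneg (r + k) (s + k) hp)
  have hS : Summable fun k : ℕ =>
      (1 / ((s : ℝ) + k + 1) ^ 2 - 1 / ((r : ℝ) + k + 1) ^ 2) / ((r : ℝ) - s) :=
    ((summable_one_div_sq_shift s).sub (summable_one_div_sq_shift r)).div_const _
  have hsum : Summable fun k => ∫ p in {p : Fin 2 → ℝ | ∀ i, p i ∈ Ioo (0 : ℝ) 1}, ‖g k p‖ :=
    hS.congr fun k => ((hnorm k).trans (hg k).2).symm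
  -- term-wise integration and telescoping
  have hswap : ∫ p in {p : Fin 2 → ℝ | ∀ i, p i ∈ Ioo (0 : ℝ) 1}, (∑' k, g k p) =
      ∑' k, ∫ p in {p : Fin 2 → ℝ | ∀ i, p i ∈ Ioo (0 : ℝ) 1}, g k p :=
    (integral_tsum_of_summable_integral_norm (fun k => (hg k).1) hsum).symm
  have hdiv : ∑' k : ℕ, (1 / ((s : ℝ) + k + 1) ^ 2 - 1 / ((r : ℝ) + k + 1) ^ 2) / ((r : ℝ) - s) =
      (∑' k : ℕ, (1 / ((s : ℝ) + k + 1) ^ 2 - 1 / ((r : ℝ) + k + 1) ^ 2)) / ((r : ℝ) - s) :=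
    tsum_div_const
  unfold logKernelIntegral
  rw [← setIntegral_congr_fun measurableSet_unitSq hexp, hswap, tsum_congr fun k => (hg k).2,
    hdiv, tsum_one_div_sq_shift_sub hsr.le]

end Beukers

end Literature.NumberTheory.Transcendental

end
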